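import Literature.Analysis.Calculus.SmoothCutoff
import Mathlib.Analysis.Calculus.Deriv.MeanValue
import Mathlib.Topology.Order.MonotoneContinuity
import Mathlib.Topology.Order.IntermediateValue
import HarnessLib

/-!
# `KerrShieldedDataExist`, line `plug-the-second-sheet` (skeleton v4 "KerrCap") — the cap profile, I:
# smooth-step blends, a global inverse function lemma, and the graph-zone radius

Support file (everything proved; no definitions, no named facts) for stub `stub_capProfile` of crux
`stmt-FinalStateConjecture-10055` (`Summit.FinalStateConjecture.FinalStateConjecture.Theses.SwallowTheDatum.KerrShieldedDataExist`).
The profile functions of the Kerr cap are glued from elementary pieces with the smooth steps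
`S((s − p)/d)` (`S = Real.smoothTransition`): a BLEND `f + S((s − p)/d) · (g − f)` is `f` below `p`, `g` above
`p + d`, is `C^∞` where `f, g` are (and `C^∞` below `p` whatever `g` is), with the Leibniz formula for its
derivative (`blend_of_le`, `blend_of_ge`, `hasDerivAt_blend`, `contDiffAt_blend`, `…_of_lt`).

* `exists_smooth_inverse` — a `C^∞` surjection `P : ℝ → ℝ` with `P′ > 0` is a bijection with `C^∞` inverse
  (Mathlib's `Homeomorph.contDiff_symm_deriv` on `StrictMono.orderIsoOfSurjective`);
* `exists_graphRadius` — the GRAPH-ZONE RADIUS `ϱ₂` of the cap: a `C^∞` strictly increasing bijection of `ℝ`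
  with `ϱ₂′ > 0`, smooth inverse, LINEAR `ϱ₂(s) = r_b + (s − σ₄)/2` up to `σ₄ + 2M + 1` and equal to the
  quasi-isotropic Boyer–Lindquist radius `q(s) = s + M + (M² − a²)/4s` of Kerr(`M, a`) (Brandt–Seidel 1996:
  `Δ(q(s)) = (s − (M² − a²)/4s)²`) from `σ₄ + 2M + 2` on — the blend of the two across `[σ₄ + 2M + 1, σ₄ + 2M + 2]`,
  where `q` exceeds the line and `q′ = 1 − (M² − a²)/4s² > 0`;
* `cap_graphRadius` — the registered export (sub-goal of `stub_capProfile`).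

References: S. R. Brandt, E. Seidel, Phys. Rev. D 54 (1996) 1403, §II (quasi-isotropic Kerr radius); M. Spivak,
*Calculus*, Ch. 12, Thm. 5 (inverse of an increasing differentiable function; folklore).
-/

set_option linter.dupNamespace false

noncomputable section

open Set Filter Topology
open scoped ContDiff Topology
open Literature.Analysis.Calculus (differentiable_smoothTransition deriv_smoothTransition_of_nonpos
  deriv_smoothTransition_of_one_le)

namespace Summit.FinalStateConjecture.FinalStateConjecture.Theorems.SwallowTheDatum

namespace KerrCap

/-! ### Smooth steps `S((s − p)/d)` and blends `f + S((s − p)/d) · (g − f)` -/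

section Blend

variable {f g : ℝ → ℝ} {p d : ℝ}

/-- The smooth step `S((s − p)/d)` (`S = Real.smoothTransition`, `d > 0`) vanishes for `s ≤ p`. [folklore] -/
theorem step_eq_zero (hd : 0 < d) {s : ℝ} (hs : s ≤ p) : Real.smoothTransition ((s - p) / d) = 0 :=
  Real.smoothTransition.zero_of_nonpos (div_nonpos_of_nonpos_of_nonneg (sub_nonpos.2 hs) hd.le)

/-- The smooth step `S((s − p)/d)` equals `1` for `s ≥ p + d`. [folklore] -/
theorem step_eq_one (hd : 0 < d) {s : ℝ} (hs : p + d ≤ s) : Real.smoothTransition ((s - p) / d) = 1 :=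
  Real.smoothTransition.one_of_one_le (by rw [le_div_iff₀ hd]; linarith)

/-- The derivative of the smooth step is `S′((s − p)/d)/d`. [folklore] -/
theorem hasDerivAt_step (p d s : ℝ) :
    HasDerivAt (fun s : ℝ ↦ Real.smoothTransition ((s - p) / d))
      (deriv Real.smoothTransition ((s - p) / d) / d) s := by
  have hin : HasDerivAt (fun s : ℝ ↦ (s - p) / d) (1 / d) s := by
    simpa using ((hasDerivAt_id' s).sub_const p).div_const d
  have h := (differentiable_smoothTransition _).hasDerivAt.comp s hin
  rwa [mul_one_div] at h

/-- The step derivative factor `S′((s − p)/d)/d` is nonnegative (`S` is monotone, `d > 0`). [folklore] -/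
theorem deriv_step_nonneg (hd : 0 < d) (s : ℝ) : 0 ≤ deriv Real.smoothTransition ((s - p) / d) / d :=
  div_nonneg Real.smoothTransition.monotone.deriv_nonneg hd.le

/-- The step derivative vanishes for `s ≤ p`. [folklore] -/
theorem deriv_step_eq_zero_of_le (hd : 0 < d) {s : ℝ} (hs : s ≤ p) :
    deriv Real.smoothTransition ((s - p) / d) = 0 :=
  deriv_smoothTransition_of_nonpos (div_nonpos_of_nonpos_of_nonneg (sub_nonpos.2 hs) hd.le)

/-- The step derivative vanishes for `s ≥ p + d`. [folklore] -/
theorem deriv_step_eq_zero_of_ge (hd : 0 < d) {s : ℝ} (hs : p + d ≤ s) :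
    deriv Real.smoothTransition ((s - p) / d) = 0 :=
  deriv_smoothTransition_of_one_le (by rw [le_div_iff₀ hd]; linarith)

/-- The smooth step is `C^∞`. [folklore] -/
theorem contDiff_step (p d : ℝ) : ContDiff ℝ ∞ (fun s : ℝ ↦ Real.smoothTransition ((s - p) / d)) :=
  Real.smoothTransition.contDiff.comp ((contDiff_id.sub contDiff_const).div_const d)

/-- A blend `f + S((s − p)/d) · (g − f)` equals `f` for `s ≤ p`. [folklore] -/
theorem blend_of_le (hd : 0 < d) {s : ℝ} (hs : s ≤ p) :
    f s + Real.smoothTransition ((s - p) / d) * (g s - f s) = f s := by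
  rw [step_eq_zero hd hs, zero_mul, add_zero]

/-- A blend `f + S((s − p)/d) · (g − f)` equals `g` for `s ≥ p + d`. [folklore] -/
theorem blend_of_ge (hd : 0 < d) {s : ℝ} (hs : p + d ≤ s) :
    f s + Real.smoothTransition ((s - p) / d) * (g s - f s) = g s := by
  rw [step_eq_one hd hs, one_mul, add_sub_cancel]

/-- The Leibniz formula for a blend: `(f + S(g − f))′ = f′ + S′/d · (g − f) + S · (g′ − f′)`. [folklore] -/
theorem hasDerivAt_blend {f' g' s : ℝ} (hf : HasDerivAt f f' s) (hg : HasDerivAt g g' s) :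
    HasDerivAt (fun s : ℝ ↦ f s + Real.smoothTransition ((s - p) / d) * (g s - f s))
      (f' + (deriv Real.smoothTransition ((s - p) / d) / d * (g s - f s) +
        Real.smoothTransition ((s - p) / d) * (g' - f'))) s :=
  hf.add ((hasDerivAt_step p d s).mul (hg.sub hf))

/-- Below `p` a blend is locally `f`, so it has the derivative of `f` there, whatever `g` is. [folklore] -/
theorem hasDerivAt_blend_of_lt (hd : 0 < d) {f' s : ℝ} (hs : s < p) (hf : HasDerivAt f f' s) :
    HasDerivAt (fun s : ℝ ↦ f s + Real.smoothTransition ((s - p) / d) * (g s - f s)) f' s := by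
  refine hf.congr_of_eventuallyEq ?_
  filter_upwards [Iio_mem_nhds hs] with t ht
  exact blend_of_le hd ht.le

/-- A blend of two functions `C^∞` at `s` is `C^∞` at `s`. [folklore] -/
theorem contDiffAt_blend {s : ℝ} (hf : ContDiffAt ℝ ∞ f s) (hg : ContDiffAt ℝ ∞ g s) :
    ContDiffAt ℝ ∞ (fun s : ℝ ↦ f s + Real.smoothTransition ((s - p) / d) * (g s - f s)) s :=
  hf.add ((contDiff_step p d).contDiffAt.mul (hg.sub hf))

/-- Below `p` a blend is locally `f`, so it is `C^∞` at `s < p` when `f` is, whatever `g` is. [folklore] -/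
theorem contDiffAt_blend_of_lt (hd : 0 < d) {s : ℝ} (hs : s < p) (hf : ContDiffAt ℝ ∞ f s) :
    ContDiffAt ℝ ∞ (fun s : ℝ ↦ f s + Real.smoothTransition ((s - p) / d) * (g s - f s)) s := by
  refine hf.congr_of_eventuallyEq ?_
  filter_upwards [Iio_mem_nhds hs] with t ht
  exact blend_of_le hd ht.le

end Blend

/-! ### A smooth surjection of `ℝ` with positive derivative has a smooth inverse -/

/-- **Global one-variable inverse function theorem.** A `C^∞` surjection `P : ℝ → ℝ` with `P′ > 0` everywhere
is a strictly increasing bijection of `ℝ` whose inverse is `C^∞` (Mathlib's `Homeomorph.contDiff_symm_deriv`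
applied to the order isomorphism `StrictMono.orderIsoOfSurjective`). [folklore] -/
theorem exists_smooth_inverse {P : ℝ → ℝ} (hP : ContDiff ℝ ∞ P) (hpos : ∀ s, 0 < deriv P s)
    (hsurj : Function.Surjective P) :
    ∃ Q : ℝ → ℝ, ContDiff ℝ ∞ Q ∧ (∀ s, Q (P s) = s) ∧ ∀ r, P (Q r) = r := by
  have hmono : StrictMono P := strictMono_of_deriv_pos hpos
  have hPd : ∀ s, HasDerivAt P (deriv P s) s := fun s ↦ ((hP.differentiable (by simp)) s).hasDerivAt
  set e : ℝ ≃o ℝ := hmono.orderIsoOfSurjective P hsurj with he_def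
  have he : (e : ℝ → ℝ) = P := hmono.coe_orderIsoOfSurjective P hsurj
  set H : ℝ ≃ₜ ℝ := e.toHomeomorph with hH_def
  have hH : (H : ℝ → ℝ) = P := by rw [hH_def, OrderIso.coe_toHomeomorph, he]
  refine ⟨H.symm, ?_, fun s ↦ ?_, fun r ↦ ?_⟩
  · refine H.contDiff_symm_deriv (f' := deriv P) (fun s ↦ (hpos s).ne') (fun s ↦ ?_) (by rw [hH]; exact hP)
    rw [hH]
    exact hPd s
  · have h := H.symm_apply_apply s
    rwa [hH] at h
  · have h := H.apply_symm_apply r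
    rwa [hH] at h

/-! ### The graph-zone radius: linear, then the quasi-isotropic Boyer–Lindquist radius -/

section Radius

variable {M a rb σ₄ : ℝ}

/-- The linear piece `r_b + (s − σ₄)/2` has derivative `1/2`. [folklore] -/
theorem hasDerivAt_linPiece (s : ℝ) : HasDerivAt (fun s : ℝ ↦ rb + (s - σ₄) / 2) (1 / 2) s := by
  simpa using (((hasDerivAt_id' s).sub_const σ₄).div_const (2 : ℝ)).const_add rb

/-- The linear piece is `C^∞`. [folklore] -/
theorem contDiffAt_linPiece (s : ℝ) : ContDiffAt ℝ ∞ (fun s : ℝ ↦ rb + (s - σ₄) / 2) s :=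
  (contDiffAt_const.add ((contDiffAt_id.sub contDiffAt_const).div_const _))

/-- The quasi-isotropic Boyer–Lindquist radius `q(s) = s + M + (M² − a²)/4s` has derivative
`q′(s) = 1 − (M² − a²)/4s²` off the origin. [cite: BrandtSeidel1996, §II] -/
theorem hasDerivAt_quasiIso {s : ℝ} (hs : s ≠ 0) :
    HasDerivAt (fun s : ℝ ↦ s + M + (M ^ 2 - a ^ 2) / (4 * s)) (1 - (M ^ 2 - a ^ 2) / (4 * s ^ 2)) s := by
  have h4 : (4 : ℝ) * s ≠ 0 := mul_ne_zero four_ne_zero hs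
  have h1 : HasDerivAt (fun s : ℝ ↦ (M ^ 2 - a ^ 2) / (4 * s))
      ((0 * (4 * s) - (M ^ 2 - a ^ 2) * (4 * 1)) / (4 * s) ^ 2) s :=
    (hasDerivAt_const s (M ^ 2 - a ^ 2)).div ((hasDerivAt_id' s).const_mul 4) h4
  have h2 := ((hasDerivAt_id' s).add_const M).add h1
  refine h2.congr_deriv ?_
  field_simp
  ring

/-- The quasi-isotropic radius is `C^∞` off the origin. [folklore] -/
theorem contDiffAt_quasiIso {s : ℝ} (hs : s ≠ 0) :
    ContDiffAt ℝ ∞ (fun s : ℝ ↦ s + M + (M ^ 2 - a ^ 2) / (4 * s)) s :=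
  (contDiffAt_id.add contDiffAt_const).add
    (contDiffAt_const.div (contDiffAt_const.mul contDiffAt_id) (mul_ne_zero four_ne_zero hs))

/-- Beyond `σ₄ + 2M + 1` the quasi-isotropic radius lies strictly above the linear piece
(`M > 0`, `a² ≤ M²`, `r_b < 2M`, `σ₄ > 0`). [folklore] -/
theorem linPiece_lt_quasiIso (hM : 0 < M) (ha : a ^ 2 ≤ M ^ 2) (hrb : rb < 2 * M) (hσ₄ : 0 < σ₄) {s : ℝ}
    (hs : σ₄ + 2 * M + 1 ≤ s) : 0 < s + M + (M ^ 2 - a ^ 2) / (4 * s) - (rb + (s - σ₄) / 2) := by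
  have hs0 : 0 < s := by linarith
  have h1 : 0 ≤ (M ^ 2 - a ^ 2) / (4 * s) := div_nonneg (by linarith) (by linarith)
  linarith

/-- Beyond `σ₄ + 2M + 1` (`σ₄ > 0`) the quasi-isotropic radius is strictly increasing: `q′ > 0`. [folklore] -/
theorem deriv_quasiIso_pos (hM : 0 < M) (hσ₄ : 0 < σ₄) {s : ℝ} (hs : σ₄ + 2 * M + 1 ≤ s) :
    0 < 1 - (M ^ 2 - a ^ 2) / (4 * s ^ 2) := by
  have hs0 : 0 < s := by linarith
  rw [sub_pos, div_lt_one (by positivity)]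
  nlinarith [sq_nonneg a]

/-- **The graph-zone radius and its inverse.** For `M > 0`, `a² ≤ M²`, `r_b < 2M`, `σ₄ > 0` there are a `C^∞`
strictly increasing `ϱ₂ : ℝ → ℝ` with `ϱ₂′ > 0` everywhere and a `C^∞` two-sided inverse `ϱinv` of it, such that
`ϱ₂(s) = r_b + (s − σ₄)/2` for `s ≤ σ₄ + 2M + 1` (so `ϱ₂(σ₄) = r_b`) and `ϱ₂(s) = s + M + (M² − a²)/4s`, the
quasi-isotropic Boyer–Lindquist radius of Kerr(`M, a`), for `s ≥ σ₄ + 2M + 2`.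
[cite: BrandtSeidel1996, §II] -/
theorem exists_graphRadius (hM : 0 < M) (ha : a ^ 2 ≤ M ^ 2) (hrb : rb < 2 * M) (hσ₄ : 0 < σ₄) :
    ∃ ϱ₂ ϱinv : ℝ → ℝ, ContDiff ℝ ∞ ϱ₂ ∧ ContDiff ℝ ∞ ϱinv ∧ StrictMono ϱ₂ ∧
      (∀ s, HasDerivAt ϱ₂ (deriv ϱ₂ s) s ∧ 0 < deriv ϱ₂ s) ∧
      (∀ s, ϱinv (ϱ₂ s) = s) ∧ (∀ r, ϱ₂ (ϱinv r) = r) ∧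
      (∀ s, s ≤ σ₄ + 2 * M + 1 → ϱ₂ s = rb + (s - σ₄) / 2) ∧
      (∀ s, σ₄ + 2 * M + 2 ≤ s → ϱ₂ s = s + M + (M ^ 2 - a ^ 2) / (4 * s)) := by
  set A : ℝ := σ₄ + 2 * M + 1 with hA
  set P : ℝ → ℝ := fun s ↦ (rb + (s - σ₄) / 2) + Real.smoothTransition ((s - A) / 1) *
      ((s + M + (M ^ 2 - a ^ 2) / (4 * s)) - (rb + (s - σ₄) / 2)) with hP
  have hlin : ∀ s, s ≤ A → P s = rb + (s - σ₄) / 2 := fun s hs ↦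
    blend_of_le (f := fun s : ℝ ↦ rb + (s - σ₄) / 2)
      (g := fun s : ℝ ↦ s + M + (M ^ 2 - a ^ 2) / (4 * s)) one_pos hs
  have hfar : ∀ s, A + 1 ≤ s → P s = s + M + (M ^ 2 - a ^ 2) / (4 * s) := fun s hs ↦
    blend_of_ge (f := fun s : ℝ ↦ rb + (s - σ₄) / 2)
      (g := fun s : ℝ ↦ s + M + (M ^ 2 - a ^ 2) / (4 * s)) one_pos hs
  -- smoothness
  have hPs : ContDiff ℝ ∞ P := by
    refine contDiff_iff_contDiffAt.2 fun s ↦ ?_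
    rcases lt_or_ge s A with hs | hs
    · exact contDiffAt_blend_of_lt one_pos hs (contDiffAt_linPiece s)
    · have hs0 : s ≠ 0 := by intro h; rw [h, hA] at hs; linarith
      exact contDiffAt_blend (contDiffAt_linPiece s) (contDiffAt_quasiIso hs0)
  -- the derivative is positive
  have hder : ∀ s, ∃ D, HasDerivAt P D s ∧ 0 < D := by
    intro s
    rcases lt_or_ge s A with hs | hs
    · exact ⟨1 / 2, hasDerivAt_blend_of_lt one_pos hs (hasDerivAt_linPiece s), by norm_num⟩
    · have hs' : σ₄ + 2 * M + 1 ≤ s := by rwa [hA] at hs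
      have hs0 : s ≠ 0 := by intro h; rw [h] at hs'; linarith
      refine ⟨_, hasDerivAt_blend (hasDerivAt_linPiece s) (hasDerivAt_quasiIso hs0), ?_⟩
      have h1 := deriv_step_nonneg (p := A) one_pos s
      have h2 := linPiece_lt_quasiIso hM ha hrb hσ₄ hs'
      have h3 := deriv_quasiIso_pos (a := a) hM hσ₄ hs'
      have h4 := Real.smoothTransition.nonneg ((s - A) / 1)
      have h5 := Real.smoothTransition.le_one ((s - A) / 1)
      have h6 := mul_nonneg h1 h2.le
      rcases eq_or_lt_of_le h5 with h7 | h7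
      · rw [h7]
        nlinarith
      · nlinarith [mul_nonneg h4 h3.le]
  have hpos : ∀ s, 0 < deriv P s := fun s ↦ by
    obtain ⟨D, hD, hD0⟩ := hder s
    rwa [hD.deriv]
  have hPd : ∀ s, HasDerivAt P (deriv P s) s := fun s ↦ ((hPs.differentiable (by simp)) s).hasDerivAt
  have hmono : StrictMono P := strictMono_of_deriv_pos hpos
  -- surjectivity: linear of slope `1/2` at `−∞`, `≥ s` at `+∞`
  have hsurj : Function.Surjective P := by
    refine hPs.continuous.surjective ?_ ?_
    · refine tendsto_atTop.2 fun b ↦ ?_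
      filter_upwards [eventually_ge_atTop (max (A + 1) b)] with s hs
      have hs1 : A + 1 ≤ s := (le_max_left _ _).trans hs
      have hs0 : 0 < s := by rw [hA] at hs1; linarith
      rw [hfar s hs1]
      have h1 : 0 ≤ (M ^ 2 - a ^ 2) / (4 * s) := div_nonneg (by linarith) (by linarith)
      linarith [le_max_right (A + 1) b]
    · refine tendsto_atBot.2 fun b ↦ ?_
      filter_upwards [eventually_le_atBot (min A (2 * (b - rb) + σ₄))] with s hs
      rw [hlin s (hs.trans (min_le_left _ _))]
      linarith [min_le_right A (2 * (b - rb) + σ₄)]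
  obtain ⟨Q, hQ, hQP, hPQ⟩ := exists_smooth_inverse hPs hpos hsurj
  refine ⟨P, Q, hPs, hQ, hmono, fun s ↦ ⟨hPd s, hpos s⟩, hQP, hPQ, hlin, fun s hs ↦ hfar s ?_⟩
  rw [hA]
  linarith

end Radius

end KerrCap

/-- **Registered export of this file** (sub-goal `cap_graphRadius` of stub `stub_capProfile`): the graph-zone
radius of the Kerr cap and its smooth inverse, `KerrCap.exists_graphRadius`. [cite: BrandtSeidel1996, §II] -/
theorem cap_graphRadius :
    ∀ (M a rb σ₄ : ℝ), 0 < M → a ^ 2 ≤ M ^ 2 → rb < 2 * M → 0 < σ₄ → ∃ ϱ₂ ϱinv : ℝ → ℝ, ContDiff ℝ ∞ ϱ₂ ∧ ContDiff ℝ ∞ ϱinv ∧ StrictMono ϱ₂ ∧ (∀ s, HasDerivAt ϱ₂ (deriv ϱ₂ s) s ∧ 0 < deriv ϱ₂ s) ∧ (∀ s, ϱinv (ϱ₂ s) = s) ∧ (∀ r, ϱ₂ (ϱinv r) = r) ∧ (∀ s, s ≤ σ₄ + 2 * M + 1 → ϱ₂ s = rb + (s - σ₄) / 2) ∧ (∀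 s, σ₄ + 2 * M + 2 ≤ s → ϱ₂ s = s + M + (M ^ 2 - a ^ 2) / (4 * s)) :=
  fun _ _ _ _ hM ha hrb hσ₄ ↦ KerrCap.exists_graphRadius hM ha hrb hσ₄

end Summit.FinalStateConjecture.FinalStateConjecture.Theorems.SwallowTheDatum

end
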